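import Summits.QuantumFields.YangMills.Theorems.AllWindowsColdBoxBoxHighLineRarityBootstrap
import Summits.QuantumFields.YangMills.Theorems.AllWindowsColdBoxBoxHighLineBoxToChartRelative
import Summits.QuantumFields.YangMills.Theorems.AllWindowsColdBoxBoxHighLineSmallFieldInsideFPByName

/-!
# RARITY BOOTSTRAP in the ASSEMBLY-S5 §1 letters — one ITERABLE step `P(¬SP(β^{ε₀−1/2})) ≤ e^{−β^{a₀}} ⟹ P(¬SP(β^{ε₁−1/2})) ≤ e^{−β^{a}}`
# (lift L5+ of `Cruxes/BoxWindowHighSU2213/U5-BLOCKERS.md`, planner ym-idea-2 g18 GO 22:16:43Z; LINE-20 U5 ⟨stmt-QuantumFields-24336⟩, LINE-19 ⟨24004⟩/⟨24335⟩)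

Width seat `ym-line-sfw-p2-w5` (prover-ym-line-sfw-p2-w5-g23-0).  ✓`BoxToChart.boxState_not_smallPlaquettes_bootstrap_window'` (this seat, p748328) with
every window hypothesis discharged in the `β`-letters EXACTLY as in w2 g31's ✓`boxPlaqCov_sub_chartCov_relative` (whose discharges (W1)–(W7), (T1)–(T3) and the
`τ`-bound are reproduced verbatim with `spl = β^{ε₀−1/2}` (coarse threshold), `s = β^{κ−1/2}` (small field), `spl′ = β^{ε₁−1/2}` (fine threshold)),
the coarse rarity entering as an ITERABLE HYPOTHESIS `∃ β₁, ∀ β ≥ β₁, P(¬SP(β^{ε₀−1/2})) ≤ exp(−β^{a₀})`: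

* ★★ `rarity_bootstrap_step` — for `0 < θ`, `12θ < 1`, `θ/2 < κ < min(ε₀, ε₁)`, `ε₀ < 1/2 − 4θ` (S4b premise), `6θ + ε₀ − 1/2 < 2κ` (T-S5.6 exponent)
  and any target `0 < a < min(4θ, a₀, 2κ)`:  `∃ β₀ ≥ 1, ∀ β ≥ β₀, P_box(¬SP(⌈β^θ⌉₊, β^{ε₁−1/2})) ≤ exp(−β^{a})`;
* ★ `rarity_bootstrap_start` — the Gibbs start (✓`exists_forall_boxState_not_smallPlaquettes_le`, `2θ < ε₀`, `a₀ = ε₀`) fed once: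
  constraint (c) `ε₁ > 2θ` of ASSEMBLY-S5 v13 replaced by `6θ + ε₀ − 1/2 < 2κ < 2ε₁` with `2θ < ε₀ < 1/2 − 4θ` — e.g. at `θ = 1/13`: `ε₁ > 0.058`.

Iterating `rarity_bootstrap_step` (its output has the shape of its input) drives the fine exponent to `(6θ − 1/2)⁺` — see ✓`…RarityBootstrap` docstring and the
memo `ym-idea-1/w5-g23-L5plus-DESIGN.md`.  Everything proved, tree only; no definitions; standard axioms.
HONEST LABEL: bookkeeping for the recorded lift L5+ of the NEXT rung U5 (unstaffed, gated) / the (5/64, 1/12) family of LINE-19; S5/T-S5.13, U5,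
⟨24004⟩ ⟨24335⟩ ⟨24336⟩ remain OPEN; no crux, rung or summit is proved; **the Yang–Mills mass gap is NOT proved by this file; no summit is proved by a line.**
-/

set_option autoImplicit false

noncomputable section

open MeasureTheory Real
open Literature.Probability.LatticeModels (Site)
open Literature.MathematicalPhysics.QuantumLattice (LGConfig fundamentalRep)
open Summit.QuantumFields.YangMills.Theorems.WeakCouplingRates (boxState)

namespace Summit.QuantumFields.YangMills.Theorems.AllWindowsColdBoxBoxHighLine

namespace BoxToChart

open ErrorBudget

/-- `3·M·exp(x + E) ≤ 1` ⇒ `M·exp(E) ≤ exp(−x)/3` (`M ≥ 0`). -/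
theorem le_third_exp_neg {M E x : ℝ} (h : 3 * M * Real.exp (x + E) ≤ 1) : M * Real.exp E ≤ Real.exp (-x) / 3 := by
  have hx : 0 < Real.exp x := Real.exp_pos x
  rw [Real.exp_add] at h
  rw [Real.exp_neg, inv_eq_one_div, div_div, le_div_iff₀ (by positivity)]
  calc M * Real.exp E * (Real.exp x * 3) = 3 * M * (Real.exp x * Real.exp E) := by ring
    _ ≤ 1 := h

/-- ★★ **One bootstrap step in `β`-letters (iterable).** -/
theorem rarity_bootstrap_step {θ κ ε₀ ε₁ a₀ a : ℝ} (hθ : 0 < θ) (h12 : 12 * θ < 1) (hκl : θ / 2 < κ) (hκε₀ : κ < ε₀) (hκε₁ : κ < ε₁)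
    (hε₀u : ε₀ < 1 / 2 - 4 * θ) (hstep : 6 * θ + ε₀ - 1 / 2 < 2 * κ) (ha : 0 < a) (ha4 : a < 4 * θ) (haa₀ : a < a₀) (ha2 : a < 2 * κ)
    (hp : ∃ β₁ : ℝ, ∀ β : ℝ, β₁ ≤ β →
      ((boxState (fundamentalRep (Fin 2)) β ⌈β ^ θ⌉₊) {U | ¬ SmallPlaquettes ⌈β ^ θ⌉₊ (β ^ (ε₀ - 1 / 2)) U}).toReal ≤ Real.exp (-(β ^ a₀))) :
    ∃ β₀ : ℝ, 1 ≤ β₀ ∧ ∀ β : ℝ, β₀ ≤ β →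
      ((boxState (fundamentalRep (Fin 2)) β ⌈β ^ θ⌉₊) {U | ¬ SmallPlaquettes ⌈β ^ θ⌉₊ (β ^ (ε₁ - 1 / 2)) U}).toReal ≤ Real.exp (-(β ^ a)) := by
  obtain ⟨K, C₅, c₅, c₀₅, hK, hC₅, hc₅, hc₀₅, hwin⟩ := boxState_not_smallPlaquettes_bootstrap_window'
  obtain ⟨C₆, c₆, c₀₆, hc₆, hc₀₆, h6'⟩ := smallFieldInsideFP
  obtain ⟨β₁, hp⟩ := hp
  obtain ⟨C₆p, hC₆p⟩ : ∃ x : ℝ, x = max C₆ 0 := ⟨_, rfl⟩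
  have hC₆p0 : 0 ≤ C₆p := by rw [hC₆p]; exact le_max_right _ _
  have hC₆le : C₆ ≤ C₆p := by rw [hC₆p]; exact le_max_left _ _
  have hθ0 : 0 ≤ θ := hθ.le
  have ha₀0 : 0 < a₀ := ha.trans haa₀
  have hmax2κ : max a θ < 2 * κ := max_lt ha2 (by linarith)
  -- the largeness conditions (ErrorBudget instances), (W·)/(T·) as in ✓`boxPlaqCov_sub_chartCov_relative`
  obtain ⟨b₁, hb₁1, hb₁⟩ := exists_forall_natPow_log_le (k := 12) (γ := 1) hθ0 (by push_cast; linarith) one_pos C₅ 0 8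
  obtain ⟨b₂, -, hb₂⟩ := exists_forall_natPow_exp_le (γ := 4 * θ) hθ0 (by positivity) hc₅ (by norm_num : (0 : ℝ) < 1 / 2) 1 0 0
  obtain ⟨b₃, -, hb₃⟩ := exists_forall_natPow_log_le (k := 4) (γ := 1 / 2 - ε₀) hθ0 (by push_cast; linarith) hc₀₅ 1 2 0
  obtain ⟨b₄, -, hb₄⟩ := exists_forall_natPow_log_le (k := 3) (γ := 1 / 2 - ε₀) hθ0 (by push_cast; linarith) one_pos (C₅ * K) 2 0
  obtain ⟨b₅, -, hb₅⟩ := exists_forall_natPow_log_le (k := 2) (γ := 1 / 2 - ε₀) hθ0 (by push_cast; linarith)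
    (by norm_num : (0 : ℝ) < 1 / 2) (C₅ * K) 2 0
  obtain ⟨b₆, -, hb₆⟩ := exists_forall_log_pow_div_rpow_le (γ := 3 * θ) (by positivity) (by norm_num : (0 : ℝ) < 1 / 2) C₅ 0
  obtain ⟨b₇, -, hb₇⟩ := exists_forall_log_pow_div_rpow_le (γ := 1 / 2 - κ) (by linarith) (by norm_num : (0 : ℝ) < 1 / 100) 1 0
  obtain ⟨b₈, -, hb₈⟩ := exists_forall_log_pow_div_rpow_le (γ := 2 * (ε₀ - κ)) (by linarith) one_pos 17 0
  obtain ⟨b₈', -, hb₈'⟩ := exists_forall_log_pow_div_rpow_le (γ := 2 * (ε₁ - κ)) (by linarith) one_pos 17 0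
  obtain ⟨b₉, -, hb₉⟩ := exists_forall_log_pow_div_rpow_le (γ := 1 / 2 - κ - 4 * θ) (by linarith) one_pos 64 2
  obtain ⟨b₁₀, -, hb₁₀⟩ := exists_forall_natPow_log_le (k := 3) (γ := 1 / 2 - ε₀) hθ0 (by push_cast; linarith)
    (by positivity : (0 : ℝ) < c₀₆ / 2) K 2 0
  obtain ⟨b₁₁, -, hb₁₁⟩ := exists_forall_log_pow_div_rpow_le (γ := 2 * θ) (by positivity) (by positivity : (0 : ℝ) < c₀₆ / 2) 1 0
  obtain ⟨b₁₂, -, hb₁₂⟩ := exists_forall_natPow_log_le (k := 0) (γ := 2 * κ) hθ0 (by push_cast; linarith) one_pos C₆ 1 0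
  -- the three final comparisons against `exp(−β^a)/3`
  obtain ⟨b₁₃, -, hb₁₃⟩ := exists_forall_natPow_exp_sub_le (γ₁ := a) (γ₁' := a) (γ₂ := 4 * θ) hθ0 (by positivity) ha4 ha4 hc₅ one_pos
    12 0 1 0 0 0
  obtain ⟨b₁₄, -, hb₁₄⟩ := exists_forall_natPow_exp_sub_le (γ₁ := a) (γ₁' := a) (γ₂ := a₀) hθ0 ha₀0 haa₀ haa₀ one_pos one_pos 12 0 1 0 0 0
  obtain ⟨b₁₅, -, hb₁₅⟩ := exists_forall_natPow_exp_sub_le (γ₁ := max a θ) (γ₁' := 6 * θ + ε₀ - 1 / 2) (γ₂ := 2 * κ) hθ0 (by linarith)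
    hmax2κ hstep hc₆ one_pos (6 * C₆p) 0 (1 + 2 * C₆p) (64 * K * (2 + θ) ^ 2 * C₆p) 4 2
  -- the threshold
  refine ⟨max (max (max (max 2 β₁) (max b₁ b₂)) (max (max b₃ b₄) (max b₅ b₆)))
    (max (max (max b₇ b₈) (max b₈' b₉)) (max (max b₁₀ b₁₁) (max (max b₁₂ b₁₃) (max b₁₄ b₁₅)))),
    le_max_of_le_left (le_max_of_le_left (le_max_of_le_left (le_max_of_le_left (by norm_num)))), ?_⟩
  intro β hβ
  simp only [max_le_iff] at hβ
  obtain ⟨⟨⟨⟨hβ2, hββ₁⟩, hβb₁, hβb₂⟩, ⟨hβb₃, hβb₄⟩, hβb₅, hβb₆⟩, ⟨⟨hβb₇, hβb₈⟩, hβb₈', hβb₉⟩, ⟨hβb₁₀, hβb₁₁⟩, ⟨hβb₁₂, hβb₁₃⟩, hβb₁₄, hβb₁₅⟩ := hβ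
  have hβ1 : 1 ≤ β := by linarith
  have hβ0 : 0 < β := by linarith
  -- abbreviate the letters
  obtain ⟨H, hHdef⟩ : ∃ H : ℕ, H = ⌈β ^ θ⌉₊ := ⟨_, rfl⟩
  obtain ⟨s, hsdef⟩ : ∃ x : ℝ, x = β ^ (κ - 1 / 2) := ⟨_, rfl⟩
  obtain ⟨spl, hspldef⟩ : ∃ x : ℝ, x = β ^ (ε₀ - 1 / 2) := ⟨_, rfl⟩
  obtain ⟨spl', hspl'def⟩ : ∃ x : ℝ, x = β ^ (ε₁ - 1 / 2) := ⟨_, rfl⟩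
  obtain ⟨r, hrdef⟩ : ∃ x : ℝ, x = K * H * (1 + Real.log H) ^ 2 * spl + 1 / ((H : ℝ) ^ 4 * (1 + Real.log β) ^ 2) := ⟨_, rfl⟩
  rw [← hHdef, ← hspl'def]
  -- `H`
  obtain ⟨hHl, hHu, hH1⟩ := ceil_rpow_bounds (θ := θ) hβ1
  rw [← hHdef] at hHl hHu hH1
  have hH1r : (1 : ℝ) ≤ H := by exact_mod_cast hH1
  have hH0 : (0 : ℝ) < H := by linarith
  have hθpos : 0 < β ^ θ := Real.rpow_pos_of_pos hβ0 θ
  have hlogβ : 0 ≤ Real.log β := Real.log_nonneg hβ1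
  have hLβ : 1 ≤ 1 + Real.log β := by linarith
  have hlogH : 0 ≤ 1 + Real.log (H : ℝ) := one_add_log_nonneg hH1r
  have hHk : ∀ k : ℕ, (H : ℝ) ^ k ≤ 2 ^ k * β ^ ((k : ℝ) * θ) := fun k => natCast_pow_le hβ1 hθ0 hHu k
  have hlgH : (1 + Real.log (H : ℝ)) ^ 2 ≤ (2 + θ) ^ 2 * (1 + Real.log β) ^ 2 := one_add_log_natCast_pow_le hβ1 hθ0 hH1 hHu 2
  have hHθk : ∀ k : ℕ, β ^ ((k : ℝ) * θ) ≤ (H : ℝ) ^ k := fun k => by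
    rw [mul_comm, Real.rpow_mul hβ0.le, Real.rpow_natCast]
    exact pow_le_pow_left₀ hθpos.le hHl k
  -- `s`, `spl`, `spl′`
  have hs0 : 0 < s := by rw [hsdef]; exact Real.rpow_pos_of_pos hβ0 _
  have hspl0 : 0 ≤ spl := by rw [hspldef]; exact Real.rpow_nonneg hβ0.le _
  have hs_eq : s = 1 / β ^ (1 / 2 - κ) := by
    rw [hsdef, one_div (β ^ (1 / 2 - κ)), ← Real.rpow_neg hβ0.le]; ring_nf
  have hspl_eq : spl = 1 / β ^ (1 / 2 - ε₀) := by
    rw [hspldef, one_div (β ^ (1 / 2 - ε₀)), ← Real.rpow_neg hβ0.le]; ring_nf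
  have hs2 : s ^ 2 = β ^ (2 * κ - 1) := by
    rw [hsdef, ← Real.rpow_natCast, ← Real.rpow_mul hβ0.le]; ring_nf
  have hspl2 : spl ^ 2 = β ^ (2 * ε₀ - 1) := by
    rw [hspldef, ← Real.rpow_natCast, ← Real.rpow_mul hβ0.le]; ring_nf
  have hspl'2 : spl' ^ 2 = β ^ (2 * ε₁ - 1) := by
    rw [hspl'def, ← Real.rpow_natCast, ← Real.rpow_mul hβ0.le]; ring_nf
  have hβs2 : β * s ^ 2 = β ^ (2 * κ) := by
    rw [hs2, show (2 : ℝ) * κ - 1 = 2 * κ + (-1) by ring, Real.rpow_add hβ0, Real.rpow_neg hβ0.le, Real.rpow_one]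
    field_simp
  -- (S1) `s ≤ 1/100`
  have hs1 : s ≤ 1 / 100 := by
    have h := hb₇ β hβb₇
    rw [pow_zero, mul_one] at h
    rwa [hs_eq]
  -- (S2) `17 s² ≤ spl²` and `17 s² ≤ spl′²`
  have hspls : 17 * s ^ 2 ≤ spl ^ 2 := by
    have h := hb₈ β hβb₈
    rw [pow_zero, mul_one, div_le_iff₀ (Real.rpow_pos_of_pos hβ0 _), one_mul] at h
    rw [hs2, hspl2]
    have e : β ^ (2 * ε₀ - 1) = β ^ (2 * (ε₀ - κ)) * β ^ (2 * κ - 1) := by rw [← Real.rpow_add hβ0]; ring_nf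
    rw [e]
    exact mul_le_mul_of_nonneg_right h (Real.rpow_nonneg hβ0.le _)
  have hspls' : 17 * s ^ 2 ≤ spl' ^ 2 := by
    have h := hb₈' β hβb₈'
    rw [pow_zero, mul_one, div_le_iff₀ (Real.rpow_pos_of_pos hβ0 _), one_mul] at h
    rw [hs2, hspl'2]
    have e : β ^ (2 * ε₁ - 1) = β ^ (2 * (ε₁ - κ)) * β ^ (2 * κ - 1) := by rw [← Real.rpow_add hβ0]; ring_nf
    rw [e]
    exact mul_le_mul_of_nonneg_right h (Real.rpow_nonneg hβ0.le _)
  -- the gap and `r`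
  have hgap0 : 0 < 1 / ((H : ℝ) ^ 4 * (1 + Real.log β) ^ 2) := by positivity
  have hr₀0 : 0 ≤ K * H * (1 + Real.log H) ^ 2 * spl := by positivity
  have hr0 : 0 < r := by rw [hrdef]; linarith
  -- (W4) `spl·H⁴(1+log H)² ≤ c₀₅`
  have hW4 : spl * (H : ℝ) ^ 4 * (1 + Real.log H) ^ 2 ≤ c₀₅ := by
    have h := hb₃ β hβb₃ H hH1 hHu
    rw [pow_zero, mul_one, one_mul] at h
    calc spl * (H : ℝ) ^ 4 * (1 + Real.log H) ^ 2 = (H : ℝ) ^ 4 * (1 + Real.log H) ^ 2 / β ^ (1 / 2 - ε₀) := by rw [hspl_eq]; ring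
      _ ≤ c₀₅ := h
  -- (W5) `C₅·(K H (1+log H)² spl)·H² ≤ 1`
  have hW5 : C₅ * (K * H * (1 + Real.log H) ^ 2 * spl) * (H : ℝ) ^ 2 ≤ 1 := by
    have h := hb₄ β hβb₄ H hH1 hHu
    rw [pow_zero, mul_one] at h
    calc C₅ * (K * H * (1 + Real.log H) ^ 2 * spl) * (H : ℝ) ^ 2 = C₅ * K * (H : ℝ) ^ 3 * (1 + Real.log H) ^ 2 / β ^ (1 / 2 - ε₀) := by
          rw [hspl_eq]; ring
      _ ≤ 1 := h
  -- (W7) `C₅ r H ≤ 1`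
  have hW7 : C₅ * r * H ≤ 1 := by
    have h1 := hb₅ β hβb₅ H hH1 hHu
    rw [pow_zero, mul_one] at h1
    have h2 := hb₆ β hβb₆
    rw [pow_zero, mul_one] at h2
    have h3 : C₅ * (1 / ((H : ℝ) ^ 4 * (1 + Real.log β) ^ 2)) * H ≤ C₅ / β ^ (3 * θ) := by
      have e : C₅ * (1 / ((H : ℝ) ^ 4 * (1 + Real.log β) ^ 2)) * H = C₅ / ((H : ℝ) ^ 3 * (1 + Real.log β) ^ 2) := by
        field_simp
      rw [e]
      refine div_le_div_of_nonneg_left hC₅.le (Real.rpow_pos_of_pos hβ0 _) ?_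
      calc β ^ (3 * θ) = β ^ (((3 : ℕ) : ℝ) * θ) := by norm_num
        _ ≤ (H : ℝ) ^ 3 := hHθk 3
        _ = (H : ℝ) ^ 3 * 1 := (mul_one _).symm
        _ ≤ (H : ℝ) ^ 3 * (1 + Real.log β) ^ 2 := mul_le_mul_of_nonneg_left (one_le_pow₀ hLβ) (by positivity)
    calc C₅ * r * H = C₅ * K * (H : ℝ) ^ 2 * (1 + Real.log H) ^ 2 / β ^ (1 / 2 - ε₀) +
          C₅ * (1 / ((H : ℝ) ^ 4 * (1 + Real.log β) ^ 2)) * H := by rw [hrdef, hspl_eq]; ring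
      _ ≤ 1 / 2 + 1 / 2 := add_le_add h1 (h3.trans h2)
      _ = 1 := by norm_num
  -- (W1) the T-S5.4J window, (W2) `e^{−c₅H⁴} ≤ 1/2`
  have hW1 : C₅ * (H : ℝ) ^ 12 * (1 + Real.log β) ^ 8 ≤ β := by
    have h := hb₁ β hβb₁ H hH1 hHu
    rw [pow_zero, mul_one, Real.rpow_one, div_le_iff₀ hβ0, one_mul] at h
    exact h
  have hδexp : Real.exp (-(c₅ * (H : ℝ) ^ 4)) ≤ Real.exp (-(c₅ * β ^ (4 * θ))) := by
    refine Real.exp_le_exp.2 (neg_le_neg (mul_le_mul_of_nonneg_left ?_ hc₅.le))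
    calc β ^ (4 * θ) = β ^ (((4 : ℕ) : ℝ) * θ) := by norm_num
      _ ≤ (H : ℝ) ^ 4 := hHθk 4
  have hW2 : Real.exp (-(c₅ * (H : ℝ) ^ 4)) ≤ 1 / 2 := by
    have h := hb₂ β hβb₂ H hH1 hHu
    rw [pow_zero, Real.rpow_zero, mul_one, mul_one, one_mul] at h
    exact hδexp.trans h
  -- (T1) `4s ≤ r`, (T2) `r H² ≤ c₀₆`, (T3) `C₆(1+log H) ≤ β s²`
  have hT1 : 4 * s ≤ r := by
    have h := hb₉ β hβb₉
    rw [div_le_iff₀ (Real.rpow_pos_of_pos hβ0 _), one_mul] at h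
    have hH4 : (H : ℝ) ^ 4 ≤ 16 * β ^ (4 * θ) := by
      calc (H : ℝ) ^ 4 ≤ 2 ^ 4 * β ^ (((4 : ℕ) : ℝ) * θ) := hHk 4
        _ = 16 * β ^ (4 * θ) := by norm_num
    have hgap : 1 / (16 * β ^ (4 * θ) * (1 + Real.log β) ^ 2) ≤ 1 / ((H : ℝ) ^ 4 * (1 + Real.log β) ^ 2) :=
      div_le_div_of_nonneg_left zero_le_one (by positivity) (mul_le_mul_of_nonneg_right hH4 (by positivity))
    have hkey : 4 * s ≤ 1 / (16 * β ^ (4 * θ) * (1 + Real.log β) ^ 2) := by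
      rw [hsdef, le_div_iff₀ (by positivity)]
      have hnn : 0 ≤ β ^ (κ - 1 / 2) * β ^ (4 * θ) := mul_nonneg (Real.rpow_nonneg hβ0.le _) (Real.rpow_nonneg hβ0.le _)
      calc 4 * β ^ (κ - 1 / 2) * (16 * β ^ (4 * θ) * (1 + Real.log β) ^ 2)
          = 64 * (1 + Real.log β) ^ 2 * (β ^ (κ - 1 / 2) * β ^ (4 * θ)) := by ring
        _ ≤ β ^ (1 / 2 - κ - 4 * θ) * (β ^ (κ - 1 / 2) * β ^ (4 * θ)) := mul_le_mul_of_nonneg_right h hnn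
        _ = β ^ ((1 / 2 - κ - 4 * θ) + (κ - 1 / 2) + 4 * θ) := by rw [Real.rpow_add hβ0, Real.rpow_add hβ0]; ring
        _ = 1 := by rw [show (1 / 2 - κ - 4 * θ) + (κ - 1 / 2) + 4 * θ = (0 : ℝ) by ring, Real.rpow_zero]
    calc 4 * s ≤ 1 / ((H : ℝ) ^ 4 * (1 + Real.log β) ^ 2) := hkey.trans hgap
      _ ≤ r := by rw [hrdef]; linarith
  have hT2 : r * (H : ℝ) ^ 2 ≤ c₀₆ := by
    have h1 := hb₁₀ β hβb₁₀ H hH1 hHu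
    rw [pow_zero, mul_one] at h1
    have h2 := hb₁₁ β hβb₁₁
    rw [pow_zero, mul_one] at h2
    have h3 : 1 / ((H : ℝ) ^ 4 * (1 + Real.log β) ^ 2) * (H : ℝ) ^ 2 ≤ 1 / β ^ (2 * θ) := by
      have e : 1 / ((H : ℝ) ^ 4 * (1 + Real.log β) ^ 2) * (H : ℝ) ^ 2 = 1 / ((H : ℝ) ^ 2 * (1 + Real.log β) ^ 2) := by
        field_simp
      rw [e]
      refine div_le_div_of_nonneg_left zero_le_one (Real.rpow_pos_of_pos hβ0 _) ?_
      calc β ^ (2 * θ) = β ^ (((2 : ℕ) : ℝ) * θ) := by norm_num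
        _ ≤ (H : ℝ) ^ 2 := hHθk 2
        _ = (H : ℝ) ^ 2 * 1 := (mul_one _).symm
        _ ≤ (H : ℝ) ^ 2 * (1 + Real.log β) ^ 2 := mul_le_mul_of_nonneg_left (one_le_pow₀ hLβ) (by positivity)
    calc r * (H : ℝ) ^ 2 = K * (H : ℝ) ^ 3 * (1 + Real.log H) ^ 2 / β ^ (1 / 2 - ε₀) +
          1 / ((H : ℝ) ^ 4 * (1 + Real.log β) ^ 2) * (H : ℝ) ^ 2 := by rw [hrdef, hspl_eq]; ring
      _ ≤ c₀₆ / 2 + c₀₆ / 2 := add_le_add h1 (h3.trans h2)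
      _ = c₀₆ := by ring
  have hT3 : C₆ * (1 + Real.log H) ≤ β * s ^ 2 := by
    have h := hb₁₂ β hβb₁₂ H hH1 hHu
    rw [pow_zero, pow_one, pow_zero, mul_one, mul_one, div_le_iff₀ (Real.rpow_pos_of_pos hβ0 _), one_mul] at h
    rwa [hβs2]
  -- τ
  have hτint := h6' H hH1 β r s hβ1 hs0 hT1 hT2 hT3
  have hrH5 : r * (H : ℝ) ^ 5 ≤ 64 * K * (2 + θ) ^ 2 * (β ^ (6 * θ + ε₀ - 1 / 2) * (1 + Real.log β) ^ 2) + 2 * β ^ θ := by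
    have h1 : K * (H : ℝ) ^ 6 * (1 + Real.log H) ^ 2 * spl ≤ 64 * K * (2 + θ) ^ 2 * (β ^ (6 * θ + ε₀ - 1 / 2) * (1 + Real.log β) ^ 2) := by
      have hH6 : (H : ℝ) ^ 6 ≤ 64 * β ^ (6 * θ) := by
        calc (H : ℝ) ^ 6 ≤ 2 ^ 6 * β ^ (((6 : ℕ) : ℝ) * θ) := hHk 6
          _ = 64 * β ^ (6 * θ) := by norm_num
      have e : β ^ (6 * θ + ε₀ - 1 / 2) = β ^ (6 * θ) * β ^ (ε₀ - 1 / 2) := by rw [← Real.rpow_add hβ0]; ring_nf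
      rw [e, hspldef]
      have := mul_le_mul (mul_le_mul hH6 hlgH (pow_nonneg hlogH 2) (by positivity)) le_rfl (Real.rpow_nonneg hβ0.le (ε₀ - 1 / 2))
        (by positivity)
      calc K * (H : ℝ) ^ 6 * (1 + Real.log H) ^ 2 * β ^ (ε₀ - 1 / 2) = K * ((H : ℝ) ^ 6 * (1 + Real.log H) ^ 2 * β ^ (ε₀ - 1 / 2)) := by ring
        _ ≤ K * (64 * β ^ (6 * θ) * ((2 + θ) ^ 2 * (1 + Real.log β) ^ 2) * β ^ (ε₀ - 1 / 2)) := mul_le_mul_of_nonneg_left this hK.le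
        _ = 64 * K * (2 + θ) ^ 2 * (β ^ (6 * θ) * β ^ (ε₀ - 1 / 2) * (1 + Real.log β) ^ 2) := by ring
    have h2 : 1 / ((H : ℝ) ^ 4 * (1 + Real.log β) ^ 2) * (H : ℝ) ^ 5 ≤ 2 * β ^ θ := by
      have e : 1 / ((H : ℝ) ^ 4 * (1 + Real.log β) ^ 2) * (H : ℝ) ^ 5 = H / (1 + Real.log β) ^ 2 := by field_simp
      rw [e]
      calc (H : ℝ) / (1 + Real.log β) ^ 2 ≤ H := div_le_self hH0.le (one_le_pow₀ hLβ)
        _ ≤ 2 * β ^ θ := natCast_le_two_mul_rpow hβ1 hθ0 hHu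
    calc r * (H : ℝ) ^ 5 = K * (H : ℝ) ^ 6 * (1 + Real.log H) ^ 2 * spl + 1 / ((H : ℝ) ^ 4 * (1 + Real.log β) ^ 2) * (H : ℝ) ^ 5 := by
          rw [hrdef]; ring
      _ ≤ _ := add_le_add h1 h2
  obtain ⟨Eτ, hEτ⟩ : ∃ x : ℝ, x = 2 * C₆p * β ^ θ + 64 * K * (2 + θ) ^ 2 * C₆p * β ^ (6 * θ + ε₀ - 1 / 2) * (1 + Real.log β) ^ 2 -
      c₆ * β ^ (2 * κ) := ⟨_, rfl⟩
  obtain ⟨τ, hτdef⟩ : ∃ x : ℝ, x = C₆p * (H : ℝ) ^ 4 * Real.exp Eτ := ⟨_, rfl⟩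
  have hτ0 : 0 ≤ τ := by rw [hτdef]; positivity
  have hexp : Real.exp (C₆ * r * (H : ℝ) ^ 5 - c₆ * β * s ^ 2) ≤ Real.exp Eτ := by
    refine Real.exp_le_exp.2 ?_
    have h1 : C₆ * r * (H : ℝ) ^ 5 ≤ C₆p * (r * (H : ℝ) ^ 5) := by
      rw [mul_assoc]; exact mul_le_mul_of_nonneg_right hC₆le (by positivity)
    have h2 : C₆p * (r * (H : ℝ) ^ 5) ≤ C₆p * (64 * K * (2 + θ) ^ 2 * (β ^ (6 * θ + ε₀ - 1 / 2) * (1 + Real.log β) ^ 2) + 2 * β ^ θ) :=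
      mul_le_mul_of_nonneg_left hrH5 hC₆p0
    have h3 : c₆ * β * s ^ 2 = c₆ * β ^ (2 * κ) := by rw [mul_assoc, hβs2]
    have h4 : C₆p * (64 * K * (2 + θ) ^ 2 * (β ^ (6 * θ + ε₀ - 1 / 2) * (1 + Real.log β) ^ 2) + 2 * β ^ θ) =
        2 * C₆p * β ^ θ + 64 * K * (2 + θ) ^ 2 * C₆p * β ^ (6 * θ + ε₀ - 1 / 2) * (1 + Real.log β) ^ 2 := by ring
    rw [hEτ]
    linarith
  have hfac : C₆ * (H : ℝ) ^ 4 * Real.exp (C₆ * r * (H : ℝ) ^ 5 - c₆ * β * s ^ 2) ≤ τ := by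
    rw [hτdef]
    calc C₆ * (H : ℝ) ^ 4 * Real.exp (C₆ * r * (H : ℝ) ^ 5 - c₆ * β * s ^ 2)
        ≤ C₆p * (H : ℝ) ^ 4 * Real.exp (C₆ * r * (H : ℝ) ^ 5 - c₆ * β * s ^ 2) :=
          mul_le_mul_of_nonneg_right (mul_le_mul_of_nonneg_right hC₆le (by positivity)) (Real.exp_pos _).le
      _ ≤ C₆p * (H : ℝ) ^ 4 * Real.exp Eτ := mul_le_mul_of_nonneg_left hexp (by positivity)
  have hI0 : 0 ≤ ∫ a in smallField H (s / 2), fpChartWeight β H r a :=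
    setIntegral_nonneg (ChartGauss.measurableSet_smallField _) fun a _ => FPChart.fpChartWeight_nonneg β r a
  have hτ : ∫ a in chartDomain H \ smallField H s, fpChartWeight β H r a ≤ τ * ∫ a in smallField H (s / 2), fpChartWeight β H r a :=
    hτint.trans (mul_le_mul_of_nonneg_right hfac hI0)
  -- the bootstrap inequality (absolute)
  have hboot := hwin H hH1 β spl spl' r s τ hβ2 hW1 hW2 hspl0 hW4 hW5 (by rw [hrdef]) hW7 hs0.le hs1 hspls hspls' hτ0 hτ
  -- the coarse rarity
  have hpβ := hp β hββ₁
  rw [← hHdef, ← hspldef] at hpβ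
  -- each of the three terms is `≤ exp(−β^a)/3`
  have hE1 : 4 * Real.exp (-(c₅ * (H : ℝ) ^ 4)) ≤ Real.exp (-(β ^ a)) / 3 := by
    have h := hb₁₃ β hβb₁₃ H hH1 hHu
    simp only [pow_zero, Real.rpow_zero, mul_one, one_mul, zero_mul, add_zero] at h
    refine (mul_le_mul_of_nonneg_left hδexp (by norm_num)).trans (le_third_exp_neg (E := -(c₅ * β ^ (4 * θ))) ?_)
    calc 3 * 4 * Real.exp (β ^ a + -(c₅ * β ^ (4 * θ))) = 12 * Real.exp (β ^ a - c₅ * β ^ (4 * θ)) := by ring_nf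
      _ ≤ 1 := h
  have hE2 : 4 * ((boxState (fundamentalRep (Fin 2)) β H) {U | ¬ SmallPlaquettes H spl U}).toReal ≤ Real.exp (-(β ^ a)) / 3 := by
    have h := hb₁₄ β hβb₁₄ H hH1 hHu
    simp only [pow_zero, Real.rpow_zero, mul_one, one_mul, zero_mul, add_zero] at h
    refine (mul_le_mul_of_nonneg_left hpβ (by norm_num)).trans (le_third_exp_neg (E := -(β ^ a₀)) ?_)
    calc 3 * 4 * Real.exp (β ^ a + -(β ^ a₀)) = 12 * Real.exp (β ^ a - β ^ a₀) := by ring_nf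
      _ ≤ 1 := h
  have hE3 : 2 * τ ≤ Real.exp (-(β ^ a)) / 3 := by
    have h := hb₁₅ β hβb₁₅ H hH1 hHu
    simp only [Real.rpow_zero, mul_one] at h
    rw [hτdef, show 2 * (C₆p * (H : ℝ) ^ 4 * Real.exp Eτ) = (2 * C₆p * (H : ℝ) ^ 4) * Real.exp Eτ by ring]
    refine le_third_exp_neg ?_
    -- `β^a + Eτ ≤ (1 + 2C₆p)·β^{max a θ} + 64K(2+θ)²C₆p·β^{6θ+ε₀−1/2}(1+log β)² − c₆β^{2κ}`
    have hm1 : β ^ a ≤ β ^ max a θ := Real.rpow_le_rpow_of_exponent_le hβ1 (le_max_left _ _)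
    have hm2 : β ^ θ ≤ β ^ max a θ := Real.rpow_le_rpow_of_exponent_le hβ1 (le_max_right _ _)
    have hle : β ^ a + Eτ ≤ (1 + 2 * C₆p) * β ^ max a θ + 64 * K * (2 + θ) ^ 2 * C₆p * β ^ (6 * θ + ε₀ - 1 / 2) * (1 + Real.log β) ^ 2 -
        c₆ * β ^ (2 * κ) := by
      have hm3 := mul_le_mul_of_nonneg_left hm2 (by positivity : (0 : ℝ) ≤ 2 * C₆p)
      rw [hEτ]
      linarith only [hm1, hm3]
    calc 3 * (2 * C₆p * (H : ℝ) ^ 4) * Real.exp (β ^ a + Eτ)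
        ≤ 3 * (2 * C₆p * (H : ℝ) ^ 4) * Real.exp ((1 + 2 * C₆p) * β ^ max a θ +
            64 * K * (2 + θ) ^ 2 * C₆p * β ^ (6 * θ + ε₀ - 1 / 2) * (1 + Real.log β) ^ 2 - c₆ * β ^ (2 * κ)) :=
          mul_le_mul_of_nonneg_left (Real.exp_le_exp.2 hle) (by positivity)
      _ = 6 * C₆p * (H : ℝ) ^ 4 * Real.exp ((1 + 2 * C₆p) * β ^ max a θ +
            64 * K * (2 + θ) ^ 2 * C₆p * β ^ (6 * θ + ε₀ - 1 / 2) * (1 + Real.log β) ^ 2 - c₆ * β ^ (2 * κ)) := by ring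
      _ ≤ 1 := h
  calc ((boxState (fundamentalRep (Fin 2)) β H) {U | ¬ SmallPlaquettes H spl' U}).toReal
      ≤ 4 * Real.exp (-(c₅ * (H : ℝ) ^ 4)) + 4 * ((boxState (fundamentalRep (Fin 2)) β H) {U | ¬ SmallPlaquettes H spl U}).toReal + 2 * τ := hboot
    _ ≤ Real.exp (-(β ^ a)) / 3 + Real.exp (-(β ^ a)) / 3 + Real.exp (-(β ^ a)) / 3 := add_le_add (add_le_add hE1 hE2) hE3
    _ = Real.exp (-(β ^ a)) := by ring

/-- ★ **The Gibbs start fed once**: for `0 < θ`, `2θ < ε₀ < 1/2 − 4θ`, `θ/2 < κ < min(ε₀, ε₁)`, `6θ + ε₀ − 1/2 < 2κ`, `0 < a < min(4θ, ε₀, 2κ)`: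
`P_box(¬SP(⌈β^θ⌉₊, β^{ε₁−1/2})) ≤ exp(−β^{a})` for `β ≥ β₀` (✓`exists_forall_boxState_not_smallPlaquettes_le` as the coarse input, `a₀ = ε₀`). -/
theorem rarity_bootstrap_start {θ κ ε₀ ε₁ a : ℝ} (hθ : 0 < θ) (hε₀θ : 2 * θ < ε₀) (hκl : θ / 2 < κ) (hκε₀ : κ < ε₀) (hκε₁ : κ < ε₁)
    (hε₀u : ε₀ < 1 / 2 - 4 * θ) (hstep : 6 * θ + ε₀ - 1 / 2 < 2 * κ) (ha : 0 < a) (ha4 : a < 4 * θ) (haε₀ : a < ε₀) (ha2 : a < 2 * κ) :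
    ∃ β₀ : ℝ, 1 ≤ β₀ ∧ ∀ β : ℝ, β₀ ≤ β →
      ((boxState (fundamentalRep (Fin 2)) β ⌈β ^ θ⌉₊) {U | ¬ SmallPlaquettes ⌈β ^ θ⌉₊ (β ^ (ε₁ - 1 / 2)) U}).toReal ≤ Real.exp (-(β ^ a)) := by
  obtain ⟨β₁, -, hp⟩ := exists_forall_boxState_not_smallPlaquettes_le hθ hε₀θ
  have h12 : 12 * θ < 1 := by linarith
  exact rarity_bootstrap_step hθ h12 hκl hκε₀ hκε₁ hε₀u hstep ha ha4 haε₀ ha2 ⟨β₁, hp⟩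

end BoxToChart

end Summit.QuantumFields.YangMills.Theorems.AllWindowsColdBoxBoxHighLine

end
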